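import Summits.CriticalPhenomena.CardyFormulaZ2.Theorems.CardyMagicRigidityNestingRigidityBigLoopsExpMoment
import HarnessLib

/-!
# Crux `NestingRigidity`, line `positive-cone-weight-doubling`: keystone K6 for the loops MEETING a
# window (however far they extend), bond-`ℤ²` half

Crux `Summit.CriticalPhenomena.CardyFormulaZ2.Theses.CardyMagicRigidity.NestingRigidity`
(stmt-CriticalPhenomena-4835), line `positive-cone-weight-doubling`, registered helper Ξ₂
`uvFarBiteSq_expMoment_latticeEnsembles`.  The far part of the UV statistic contains the big loops
OUTSIDE `B̄(0, 1 + 2δ)` biting the ring `{1 ≤ |z| < 2}`: loops of diameter `≥ η` MEETING `B̄(0, 2)` and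
possibly leaving every bounded window (the loops crossing the annulus `{2 ≤ |z| ≤ 4}`).  Keystone K6
(`expMoment_ncard_bigLoops_le`, …BigLoopsExpMoment) counts only the loops INSIDE a window; this file
proves the stronger bond-`ℤ²` statement for the loops MEETING the window (anchor
`expMoment_ncard_bigLoops_meeting_le_zEns`): `E_δ[exp(s · #{u ∈ X_δ : trace u ∩ B̄(0, R) ≠ ∅,
diam (trace u) ≥ η})] ≤ C` for all `0 < δ ≤ η/c₀` — by the proof of `expMoment_ncard_bigLoops_le_zEns`
VERBATIM (thin cover of `B̄(0, R)` by discs of radius `r(s, η)`, first-disc patterns, the joint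
disjoint occurrence of the confined annulus crossings of …BigLoopsExpMomentBK, iterated BK–Reimer,
RSW, self-duality, and the summation `BigLoopsExp.integral_exp_le_of_jointTails`): that proof used
the window only through (i) a point of the trace in `B̄(0, R)` (to find the first disc) and (ii) the
finiteness of the family of loops meeting `B̄(0, R)` at a fixed mesh — both available for the loops
MEETING the window (§1).  No cited fact, no definition.
-/

noncomputable section

open MeasureTheory Set Filter Metric
open scoped Real Topology BigOperators ENNReal

namespace Summit.CriticalPhenomena.CardyFormulaZ2.Cruxes.NestingRigidity.PositiveConeWeightDoubling

open Literature.Probability.RandomPlanarGeometry Literature.Probability.Percolation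
  Literature.Probability.LatticeModels
open Literature.Probability.Percolation.SSContinuity (measure_preimage_dualConfig_le)
open Summit.CriticalPhenomena.CardyFormulaZ2.Cruxes.NestingRigidity.RingCloudTomography

namespace BigLoopsMeet

/-! ## §1 Loops meeting a window: finiteness and a deterministic bound at a fixed mesh -/

/-- On both lattice ensembles, at a fixed mesh `δ > 0`, the loops MEETING `B̄(0, R)` cut out by any
further predicate form a finite set of deterministically bounded cardinality
(`FirstMoment.exists_ncard_loops_meeting_le`). -/
theorem exists_ncard_loops_sep_meeting_le : ∀ E ∈ latticeEnsembles, ∀ {δ : ℝ}, 0 < δ → ∀ R : ℝ,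
    ∃ N : ℕ, ∀ (Q : UnbasedLoop ℂ → Prop), (∀ u, Q u → (u.range ∩ closedBall (0 : ℂ) R).Nonempty) →
      ∀ ω : E.Ω, {u ∈ (E.X δ ω).loops | Q u}.Finite ∧ {u ∈ (E.X δ ω).loops | Q u}.ncard ≤ N := by
  intro E hE δ hδ R
  obtain ⟨N, hN⟩ := FirstMoment.exists_ncard_loops_meeting_le E hE hδ R
  refine ⟨N, fun Q hQ ω ↦ ?_⟩
  obtain ⟨hfin, hle⟩ := hN ω
  have hsub : {u ∈ (E.X δ ω).loops | Q u} ⊆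
      {u ∈ (E.X δ ω).loops | (u.range ∩ closedBall (0 : ℂ) R).Nonempty} :=
    fun u hu ↦ ⟨hu.1, hQ u hu.2⟩
  exact ⟨hfin.subset hsub, (ncard_le_ncard hsub hfin).trans hle⟩

end BigLoopsMeet

/-! ## §2 The bond-`ℤ²` statement -/

/-- **K6 for the loops MEETING a window, bond-`ℤ²`: all-order exponential moments, uniformly in the
mesh.**  For all `s R η` with `0 < η ≤ R` there are `C, c₀ > 0` such that for every mesh `0 < δ` with
`c₀ δ ≤ η`, the number `N` of loops of `zEns.X δ = bondLoopConfig δ 0` whose trace MEETS `B̄(0, R)` and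
has diameter `≥ η` (no confinement: the loops crossing out of every window are counted) has
`E[exp(s N)] ≤ C` (integrability included) — the proof of `expMoment_ncard_bigLoops_le_zEns` verbatim
(thin covering, first-disc patterns, joint disjoint occurrence of confined annulus crossings,
iterated BK–Reimer, RSW, self-duality, `BigLoopsExp.integral_exp_le_of_jointTails`);
`C = 2 · 2^{81 (R/r)²}`, `r = (η/16)(e^{-2 max(s,0)}/2)^{1/α}`, `c₀ = max(c₁, 8) η / r`. -/
theorem expMoment_ncard_bigLoops_meeting_le_zEns : ∀ (s R η : ℝ), 0 < η → η ≤ R → ∃ C c₀ : ℝ, 0 < C ∧ 0 < c₀ ∧ ∀ δ : ℝ, 0 < δ → c₀ * δ ≤ η → Integrable (fun ω ↦ Real.exp (s * ({u ∈ (zEns.X δ ω).loops | (u.range ∩ Metric.closedBall (0 : ℂ) R).Nonempty ∧ η ≤ Metric.diam u.range}.ncard : ℝ))) zEns.P ∧ ∫ ω, Real.exp (s * ({u ∈ (zEns.X δ ω).loops | (u.range ∩ Metric.closedBall (0 : ℂ) R).Nonempty ∧ η ≤ Metric.diam u.range}.ncard : ℝ)) ∂zEns.P ≤ C := by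
  classical
  intro s R η hη hηR
  haveI : IsProbabilityMeasure zEns.P := isProbabilityMeasure_of_mem zEns_mem
  obtain ⟨α, c₁, hα, hc₁, hbd⟩ := annulusOpenCrossing_half_le_holds
  -- the order `t ≥ 0`, the tail parameter `p`, the disc radius `r`
  set t : ℝ := max s 0 with ht_def
  have ht0 : 0 ≤ t := le_max_right _ _
  have hst : s ≤ t := le_max_left _ _
  set p : ℝ := Real.exp (-(2 * t)) / 2 with hp_def
  have hp0 : 0 < p := by positivity
  have hp1 : p ≤ 1 := by
    have : Real.exp (-(2 * t)) ≤ 1 := Real.exp_le_one_iff.2 (by linarith)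
    rw [hp_def]; linarith
  have hqp : Real.exp (2 * t) * p ≤ 1 / 2 := by
    rw [hp_def, ← mul_div_assoc, ← Real.exp_add, add_neg_cancel, Real.exp_zero]
  set r : ℝ := η / 16 * p ^ (1 / α) with hr_def
  have hpα : p ^ (1 / α) ≤ 1 := Real.rpow_le_one hp0.le hp1 (by positivity)
  have hr0 : 0 < r := by positivity
  have hrη : r ≤ η / 16 := by rw [hr_def]; exact mul_le_of_le_one_right (by positivity) hpα
  have hrR : r ≤ R := by linarith
  have hkey : (16 * r / η) ^ α = p := by
    have h16 : 16 * r / η = p ^ (1 / α) := by rw [hr_def]; field_simp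
    rw [h16, ← Real.rpow_mul hp0.le, one_div_mul_cancel hα.ne', Real.rpow_one]
  -- the cover of `B̄(0, R)` by `B ≤ 81 (R/r)²` discs of radius `r`
  obtain ⟨S, hScard, hcover⟩ := BigLoops.exists_cover_closedBall hr0 hrR
  set B : ℕ := S.card with hB
  set c : Fin B → ℂ := fun i ↦ (r : ℂ) * ((S.equivFin.symm i : S) : ℂ) with hc
  have hcov : ∀ z ∈ closedBall (0 : ℂ) R, ∃ i, z ∈ closedBall (c i) r := by
    intro z hz
    obtain ⟨y, hy, hzy⟩ := mem_iUnion₂.1 (hcover hz)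
    refine ⟨S.equivFin ⟨y, hy⟩, ?_⟩
    rw [hc]
    dsimp only
    rw [Equiv.symm_apply_apply]
    exact hzy
  -- the constants
  set κ : ℝ := max c₁ 8 with hκ
  have hκ8 : 8 ≤ κ := le_max_right _ _
  have hκc : c₁ ≤ κ := le_max_left _ _
  have hBC : (2 : ℝ) * 2 ^ B ≤ 2 * (2 : ℝ) ^ (81 * (R / r) ^ 2) := by
    refine mul_le_mul_of_nonneg_left ?_ (by norm_num)
    rw [← Real.rpow_natCast]
    exact Real.rpow_le_rpow_of_exponent_le (by norm_num) hScard
  refine ⟨2 * (2 : ℝ) ^ (81 * (R / r) ^ 2), κ * η / r, by positivity, by positivity,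
    fun δ hδ hδη ↦ ?_⟩
  -- mesh conditions
  have hκδ : κ * δ ≤ r := by
    rw [div_mul_eq_mul_div, div_le_iff₀ hr0] at hδη
    exact le_of_mul_le_mul_right (by linarith) hη
  have hδr : 8 * δ ≤ r := le_trans (mul_le_mul_of_nonneg_right hκ8 hδ.le) hκδ
  have hc₁δ : c₁ * δ ≤ r := le_trans (mul_le_mul_of_nonneg_right hκc hδ.le) hκδ
  have hab : r + 2 * δ ≤ η / 4 := by linarith
  have hratio : (r + δ) / (η / 4 - δ) ≤ 16 * r / η := by
    rw [div_le_div_iff₀ (by linarith) hη]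
    nlinarith [mul_le_mul_of_nonneg_right hδr hη.le,
      mul_le_mul_of_nonneg_left hδr (by positivity : (0 : ℝ) ≤ 2 * r),
      mul_le_mul_of_nonneg_left hrη (by positivity : (0 : ℝ) ≤ 2 * r), mul_pos hr0 hη]
  have hpA : ∀ x : ℂ, (bondPercolation (zdGraph 2) half).real
      (annulusOpenCrossing x δ (r + δ) (η / 4 - δ)) ≤ p := by
    intro x
    refine (hbd x δ (r + δ) (η / 4 - δ) hδ (by linarith) (by linarith)).trans ?_
    rw [← hkey]
    exact Real.rpow_le_rpow (div_nonneg (by linarith) (by linarith)) hratio hα.le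
  -- the statistic: measurability, boundedness, integrability
  set big : UnbasedLoop ℂ → Prop := fun u ↦
    (u.range ∩ Metric.closedBall (0 : ℂ) R).Nonempty ∧ η ≤ Metric.diam u.range with hbig
  obtain ⟨Mb, hMb⟩ := BigLoopsMeet.exists_ncard_loops_sep_meeting_le zEns zEns_mem hδ R
  have hmeasN : Measurable fun ω ↦ ({u ∈ (zEns.X δ ω).loops | big u}.ncard : ℝ) :=
    measurable_from_nat.comp (BigLoops.measurable_ncard_loops_sep zEns zEns_mem δ big)
  have hint : ∀ a : ℝ, Integrable
      (fun ω ↦ Real.exp (a * ({u ∈ (zEns.X δ ω).loops | big u}.ncard : ℝ))) zEns.P := by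
    intro a
    refine Integrable.of_bound (Real.measurable_exp.comp (hmeasN.const_mul a)).aestronglyMeasurable
      (Real.exp (|a| * Mb)) (Eventually.of_forall fun ω ↦ ?_)
    rw [Real.norm_eq_abs, Real.abs_exp]
    refine Real.exp_le_exp.2 ?_
    have h1 : ({u ∈ (zEns.X δ ω).loops | big u}.ncard : ℝ) ≤ Mb := by
      exact_mod_cast (hMb big (fun u h ↦ h.1) ω).2
    have h2 : (0 : ℝ) ≤ ({u ∈ (zEns.X δ ω).loops | big u}.ncard : ℝ) := Nat.cast_nonneg _
    calc a * ({u ∈ (zEns.X δ ω).loops | big u}.ncard : ℝ)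
        ≤ |a| * ({u ∈ (zEns.X δ ω).loops | big u}.ncard : ℝ) :=
          mul_le_mul_of_nonneg_right (le_abs_self a) h2
      _ ≤ |a| * Mb := mul_le_mul_of_nonneg_left h1 (abs_nonneg a)
  refine ⟨hint s, ?_⟩
  -- reduce to the order `t`
  have hmono : ∫ ω, Real.exp (s * ({u ∈ (zEns.X δ ω).loops | big u}.ncard : ℝ)) ∂zEns.P ≤
      ∫ ω, Real.exp (t * ({u ∈ (zEns.X δ ω).loops | big u}.ncard : ℝ)) ∂zEns.P :=
    integral_mono (hint s) (hint t) fun ω ↦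
      Real.exp_le_exp.2 (mul_le_mul_of_nonneg_right hst (Nat.cast_nonneg _))
  refine hmono.trans (le_trans ?_ hBC)
  -- the pattern events
  set A₁ : Fin B → Set (BondConfig (Site 2)) := fun i ↦
    annulusOpenCrossing (c i) δ (r + δ) (η / 4 - δ) with hA₁
  set A₀ : Fin B → Set (BondConfig (Site 2)) := fun i ↦
    annulusOpenCrossing (c i - δ * (1 + Complex.I) / 2) δ (r + δ) (η / 4 - δ) with hA₀
  set EV₁ : (Fin B → ℕ) → Set (BondConfig (Site 2)) := fun f ↦
    (List.ofFn fun i ↦ disjointOccurrencePow (A₁ i) (f i)).foldr disjointOccurrence univ with hEV₁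
  set EV₀ : (Fin B → ℕ) → Set (BondConfig (Site 2)) := fun f ↦ dualConfig ⁻¹'
    (List.ofFn fun i ↦ disjointOccurrencePow (A₀ i) (f i)).foldr disjointOccurrence univ with hEV₀
  -- common determining finite sets of edges
  have hdet : ∀ y : ℂ, ∃ F : Finset (Sym2 (Site 2)),
      DeterminedBy (annulusOpenCrossing y δ (r + δ) (η / 4 - δ)) ↑F :=
    fun y ↦ ⟨_, determinedBy_annulusOpenCrossing hδ y _ _⟩
  choose Fd hFd using hdet
  set F₁ : Finset (Sym2 (Site 2)) := Finset.univ.biUnion fun i ↦ Fd (c i) with hF₁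
  set F₀ : Finset (Sym2 (Site 2)) := Finset.univ.biUnion fun i ↦ Fd (c i - δ * (1 + Complex.I) / 2)
    with hF₀
  have hA₁F : ∀ i, DeterminedBy (A₁ i) ↑F₁ := fun i ↦ (hFd (c i)).mono fun e he ↦ by
    rw [hF₁, Finset.coe_biUnion]
    exact mem_iUnion₂.2 ⟨i, Finset.mem_coe.2 (Finset.mem_univ i), he⟩
  have hA₀F : ∀ i, DeterminedBy (A₀ i) ↑F₀ := fun i ↦
    (hFd (c i - δ * (1 + Complex.I) / 2)).mono fun e he ↦ by
      rw [hF₀, Finset.coe_biUnion]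
      exact mem_iUnion₂.2 ⟨i, Finset.mem_coe.2 (Finset.mem_univ i), he⟩
  -- BK–Reimer
  have hBK : ∀ (F : Finset (Sym2 (Site 2))) (A A' : Set (BondConfig (Site 2))), IsUpperSet A →
      IsUpperSet A' → DeterminedBy A ↑F → DeterminedBy A' ↑F →
      (bondPercolation (zdGraph 2) half).real (A □ A') ≤
        (bondPercolation (zdGraph 2) half).real A * (bondPercolation (zdGraph 2) half).real A' :=
    fun F A A' _ _ hA hA' ↦ reimer_holds (zdGraph 2) half ⟨F, hA⟩ ⟨F, hA'⟩
  -- joint geometric tails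
  have htail : ∀ (A : Fin B → Set (BondConfig (Site 2))) (F : Finset (Sym2 (Site 2)))
      (f : Fin B → ℕ), (∀ i, IsUpperSet (A i)) → (∀ i, DeterminedBy (A i) ↑F) →
      (∀ i, (bondPercolation (zdGraph 2) half).real (A i) ≤ p) →
      (bondPercolation (zdGraph 2) half).real ((List.ofFn fun i ↦
        disjointOccurrencePow (A i) (f i)).foldr disjointOccurrence univ) ≤ p ^ (∑ i, f i) := by
    intro A F f hAu hAF hAp
    refine (BigLoopsExp.measureReal_foldr_ofFn_le_prod _ (hBK F) A f hAu hAF).trans ?_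
    rw [← Finset.prod_pow_eq_pow_sum]
    exact Finset.prod_le_prod (fun i _ ↦ pow_nonneg measureReal_nonneg _) fun i _ ↦
      pow_le_pow_left₀ measureReal_nonneg (hAp i) _
  have hP₁ : ∀ f, (bondPercolation (zdGraph 2) half).real (EV₁ f) ≤ p ^ (∑ i, f i) := fun f ↦
    htail A₁ F₁ f (fun i ↦ isUpperSet_annulusOpenCrossing _ δ _ _) hA₁F fun i ↦ hpA _
  have hP₀ : ∀ f, (bondPercolation (zdGraph 2) half).real (EV₀ f) ≤ p ^ (∑ i, f i) := fun f ↦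
    (ENNReal.toReal_mono (measure_ne_top _ _) (measure_preimage_dualConfig_le _)).trans
      (htail A₀ F₀ f (fun i ↦ isUpperSet_annulusOpenCrossing _ δ _ _) hA₀F fun i ↦ hpA _)
  have hm₁ : ∀ f, MeasurableSet (EV₁ f) := fun f ↦
    (BigLoopsExp.determinedBy_foldr (BigLoopsExp.determinedBy_of_mem_ofFn hA₁F f)).measurableSet_of_finset
  have hm₀ : ∀ f, MeasurableSet (EV₀ f) := fun f ↦ measurable_dualConfig
    (BigLoopsExp.determinedBy_foldr (BigLoopsExp.determinedBy_of_mem_ofFn hA₀F f)).measurableSet_of_finset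
  -- summation
  change ∫ ω, Real.exp (t * ({u ∈ (bondLoopConfig δ 0 ω).loops | big u}.ncard : ℝ))
    ∂(bondPercolation (zdGraph 2) half) ≤ 2 * 2 ^ B
  refine BigLoopsExp.integral_exp_le_of_jointTails (bondPercolation (zdGraph 2) half) ht0 hp0.le hqp
    EV₁ EV₀ hm₁ hm₀ hP₁ hP₀ (M := Mb)
    (N := fun ω ↦ {u ∈ (bondLoopConfig δ 0 ω).loops | big u}.ncard) (hint t) ?_
  -- the patterns, on lattice configurations
  filter_upwards [ae_subset_edgeSet (zdGraph 2) half] with ω hω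
  set meets : Fin B → UnbasedLoop ℂ → Prop := fun i u ↦ (u.range ∩ closedBall (c i) r).Nonempty
    with hmeets
  set T : Fin 2 → Fin B → Set (UnbasedLoop ℂ) := fun τ i ↦
    {u ∈ (bondLoopConfig δ 0 ω).F τ | big u ∧ (meets i u ∧ ∀ j < i, ¬ meets j u)} with hT
  have hBigfin : {u ∈ (bondLoopConfig δ 0 ω).loops | big u}.Finite := (hMb big (fun u h ↦ h.1) ω).1
  have hTsub : ∀ τ i, T τ i ⊆ {u ∈ (bondLoopConfig δ 0 ω).loops | big u} :=
    fun τ i u hu ↦ ⟨LoopConfig.subset_loops _ τ hu.1, hu.2.1⟩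
  have hTfin : ∀ τ i, (T τ i).Finite := fun τ i ↦ hBigfin.subset (hTsub τ i)
  have hTle : ∀ τ i, (T τ i).ncard ≤ Mb := fun τ i ↦
    (ncard_le_ncard (hTsub τ i) hBigfin).trans (hMb big (fun u h ↦ h.1) ω).2
  have hTdisj : ∀ τ, Pairwise fun i i' ↦ Disjoint (T τ i) (T τ i') := by
    intro τ i i' hii'
    rw [Set.disjoint_left]
    rintro u ⟨-, -, hfi⟩ ⟨-, -, hfi'⟩
    rcases lt_or_gt_of_ne hii' with h | h
    · exact hfi'.2 i h hfi.1
    · exact hfi.2 i' h hfi'.1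
  have hmeet : ∀ τ i, ∀ u ∈ T τ i, (u.range ∩ Metric.closedBall (c i) r).Nonempty ∧
      (u.range ∩ (Metric.ball (c i) (η / 4))ᶜ).Nonempty := by
    rintro τ i u ⟨-, ⟨-, hdiam⟩, hfi⟩
    refine ⟨hfi.1, ?_⟩
    by_contra hcon
    have hsub : u.range ⊆ ball (c i) (η / 4) := fun z hz ↦ by
      by_contra hz'
      exact hcon ⟨z, hz, hz'⟩
    have := (diam_mono hsub isBounded_ball).trans (diam_ball (by positivity : (0 : ℝ) ≤ η / 4))
    linarith
  refine ⟨fun i ↦ (T 1 i).ncard, fun i ↦ (T 0 i).ncard, hTle 1, hTle 0, ?_, ?_, ?_⟩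
  · exact BigLoopsExp.mem_foldr_of_typeOne_families hω hδ (a := fun _ ↦ r) (b := fun _ ↦ η / 4)
      (fun _ ↦ hab) c (T 1) (fun i u hu ↦ hu.1) (hTfin 1) (hTdisj 1) (hmeet 1) _ fun i ↦ le_rfl
  · exact BigLoopsExp.mem_foldr_dualConfig_of_typeZero_families hω hδ (a := fun _ ↦ r)
      (b := fun _ ↦ η / 4) (fun _ ↦ hab) c (T 0) (fun i u hu ↦ hu.1) (hTfin 0) (hTdisj 0)
      (hmeet 0) _ fun i ↦ le_rfl
  · -- every big loop has a type and a first disc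
    have hsub : {u ∈ (bondLoopConfig δ 0 ω).loops | big u} ⊆
        ⋃ i ∈ (Finset.univ : Finset (Fin B)), (T 1 i ∪ T 0 i) := by
      rintro u ⟨hu, hbu⟩
      obtain ⟨z, hz, hzR⟩ := hbu.1
      obtain ⟨i₀, hi₀⟩ := hcov z hzR
      obtain ⟨i, hi, hmin⟩ := BigLoopsExp.exists_first (fun i ↦ meets i u) ⟨i₀, z, hz, hi₀⟩
      refine mem_iUnion₂.2 ⟨i, Finset.mem_univ _, ?_⟩
      rcases LoopConfig.mem_loops_iff.1 hu with h0 | h1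
      · exact Or.inr ⟨h0, hbu, hi, hmin⟩
      · exact Or.inl ⟨h1, hbu, hi, hmin⟩
    have hUfin : (⋃ i ∈ (Finset.univ : Finset (Fin B)), (T 1 i ∪ T 0 i)).Finite :=
      hBigfin.subset (iUnion₂_subset fun i _ ↦ union_subset (hTsub 1 i) (hTsub 0 i))
    calc {u ∈ (bondLoopConfig δ 0 ω).loops | big u}.ncard
        ≤ (⋃ i ∈ (Finset.univ : Finset (Fin B)), (T 1 i ∪ T 0 i)).ncard := ncard_le_ncard hsub hUfin
      _ ≤ ∑ i, (T 1 i ∪ T 0 i).ncard := Finset.set_ncard_biUnion_le _ _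
      _ ≤ ∑ i, ((T 1 i).ncard + (T 0 i).ncard) := Finset.sum_le_sum fun i _ ↦ ncard_union_le _ _
      _ = ∑ i, (T 1 i).ncard + ∑ i, (T 0 i).ncard := Finset.sum_add_distrib

end Summit.CriticalPhenomena.CardyFormulaZ2.Cruxes.NestingRigidity.PositiveConeWeightDoubling

end
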